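import Summits.QuantumFields.BalabanUV.T4Continuum.Spine.NE1p.DressedSmallFieldRecordLabelsTorus
import Summits.QuantumFields.BalabanUV.T4Continuum.Spine.NE1p.DressedSmallFieldInnerLabelsRefinedWitness

/-!
# T⁴ programme, spine estimate NE1′ (node O3b/H2) — WITNESS «N0y's RECORD-LABEL ENDs FIRE ON THE NESTED TORI AT ROW NE5's LABEL TYPE —
# BOTH DICTIONARY BRANCHES LIVE»: S53 §2's `attachedPart_locE_le_of_coresAt_pencil_recordLabels_refined` AND its road-P1 twin
# `muPart_locE_le_of_coresAt_pencil_recordLabels_refined` APPLIED ONCE EACH BY NAME — decided appliers — on the nested tori `(N, L·N)` at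
# TWO record labels `⟨Z₀, fam, P⟩` of NE5's type conditioned at the refined unit block: the FAMILY branch `⟨blk, {blk}, ∅⟩` and the BOND
# branch `⟨blk, ∅, blk⟩` (all `L⁴` fine cubes uncovered, every cube a bond), where N0y's finer constraints `P ⊆ bondsOf (Z₀ ∖ ∪fam)`,
# `#(Z₀ ∖ ∪fam) ≤ 2·#P` are met NON-vacuously (`#W = L⁴`, `#P = L⁴`)

Cell `pub-balaban`, sub-cell `t4`, row NE1′ formalisation crew (`t4/formal/NE1p/LEAVES.md` row W⟨next⟩; INTENT `HOME/CLAIMS.log`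
2026-08-20), unit `b2b-balaban-t4-ne1p-formalise-leaf-05` (gen 12); PART 1 of 2 (D1).  ADDITIVE — imports S53
`Spine/NE1p/DressedSmallFieldRecordLabelsTorus` (leaf-05 g12, p238702; → the owner's N0y, S40.1, S43.1) and W71 PART 1
`Spine/NE1p/DressedSmallFieldInnerLabelsRefinedWitness` (leaf-06 g12, p239261 — imported for its located numerals `RR`∕`sR`∕`hRR_R`∕`hκ_R`,
its datum `blk`∕`card_blk`, and, through it, W59.1's `hsmall_N`, W45's `h229_F`, W41∕W35∕W33∕W24's toy letters and row NE5's toy frame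
BY NAME) ONLY — all LANDED; toy DATA `def`s + theorems; 0 `def … : Prop`, 0 cite, 0 sorry, 0 `attribute`; nothing of S53 ∕ N0y ∕ W71 ∕
W59 ∕ W45 ∕ W41 ∕ W35 ∕ W33 ∕ W24 ∕ S47 ∕ S43 ∕ pv22 is restated — their declarations are used BY NAME.

WHY.  S53 (leaf-05 g12) put the owner's N0y — the second-step count and the cores' ENDs RE-INDEXED by row NE5's label TYPE of record
`B13StepTermLabels.InnerLabel ⟨Z₀, fam, P⟩` — on pv22's nested tori `(N, L·N)` with `foot := trefineDom L N` and the link supplied; its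
§2 is what the owner's N1a «N0y at the carriers of record» consumes BY NAME.  N0y's dictionary `⟨Z₀, fam, P⟩ ↦ ⟨Z₀ ∖ ∪fam, (fam, P)⟩`
has TWO extreme branches — everything covered by the family (`W = ∅`, `P = ∅`) and nothing covered (`fam = ∅`, `W = Z₀`, bonds on
every cube) — and N0y's `hadm` carries print's finer constraints (p. 12 «P ⊂ Y₀^{c*}», p. 18 «|P| ≥ ½M⁻⁴|Z₀∖Y₀|») INLINE as clauses 3–4.
W71 (leaf-06 g12) fired S48 (N0u's Σ-index) at the family branch only.  No decided datum inhabits S53's NE5-typed ENDs, and none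
exercises the bond branch or the μ-part twin on two tori.  Here:
* §1 THE TWO LABELS (toy DATA) on W71's refined unit block `blk := trefineDom L N X₀` (`L⁴` fine cubes): `labF := ⟨blk, {blk}, ∅⟩`
  (family branch) and `labB := ⟨blk, ∅, blk.1⟩` (bond branch, bonds READ AS CUBES `Bnd := TPt 4 (L·N)`, `bondsOf := id`, `b₀ := 1`);
  `labF ≠ labB`; the term indexing `termsI` (both labels at `X₀`, nothing elsewhere), `termsI_X₀_card = 2`; **`hadm_I`** — N0y's four
  clauses MET on both labels, clauses 3–4 WITH CONTENT on `labB` (`P = W = blk.1`, `#W = L⁴ ≤ 2·L⁴`);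
* §2 the label-indexed cores (toy DATA): N0y's table-blind majorant `majI ℓ := (Π_{Y∈fam} α₆F·e^{−δFκF·d(Y)}·e^{−RR(d(Y)+5)})·
  (sR²·1)^{#P}` at W71's located letters; `majI labF = α₆F·e^{−δFκF·d_B}·e^{−RR(d_B+5)}` (W71's `majR lab`, the fine tree length
  `d_B` of the refined block) and **`majI labB = (sR²)^{L⁴}`** — the bond letter `(s²t)^{#P}` is LIVE; W33's one-label core at the weight
  `(cM r∕2)·majI ℓ`; `hAmp_I` (attached, radius `ϱ = 2`) and `hAmpMu_I` (μ-part, `A := A∕2`, radius `μ₁ = 2`) by W41's `budget_half`;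
* §3 **`recordEnd_fires`** — S53 §2's attached-part END ONCE BY NAME, every `N`, `L`; closed form `≤ K₀(64,8)`;
  **`recordMuEnd_fires`** — S53 §2's μ-part END ONCE BY NAME at `(μ₀, μ₁) = (1, 2)`, `‖sμ‖ ≤ 1`, `A := A∕2` (smallness = W59's
  `hsmall_N` rearranged, `hsmall_mu`); closed form `≤ K₀(64,8)∕4 · … `; road P1's μ-twin thus has a decided applier on two tori;
* PART 2 (`…RecordLabelsTorusWitnessLive`, imports THIS file only) LOCATED ∕ GENUINE: the activity at `X₀` in closed form (TWO cores),
  liveness of both ENDs' quantities, the bond branch STRICTLY LIGHTER than the family branch on the datum, W71's `hmono_strict` re-read.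

HONEST FRAMING.  A DECIDED TOY ([folklore]; 0 sorry; 0 citations; no `def … : Prop` — the `def`s are toy DATA): TWO terms on ONE
polymer — a vacuity check of S53's NE5-typed ENDs with both branches of N0y's dictionary inhabited, nothing more; the cores are
THEOREM-backed instances of the cell's typed FORMAT of (2.14) over row NE5's TOY frame — NOT Bałaban's (2.14) terms; «the refined block
covered by itself» ∕ «every fine cube uncovered and a bond» are OUR toy choices ((B1b) NOT claimed: Bałaban's terms of `Z` are NOT shown to
be these labels; bonds read as cubes is the W-witnesses' toy reading, the substrate's (A′) carries print's unit-lattice bonds); (B3-amp)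
MET because the weight is CHOSEN as N0y's majorant — UNPRINTED for Bałaban's cores (GAPS G-ne9p2-5); WHICH pair `(N, L·N)` is Bałaban's
`(𝐃_{k+1}, 𝐃_k)` stays pv22's READING (D-pv22.3); `RR`, `sR`, `½`, `A∕4`, `A∕2` are OUR numerals over pv22's located `64 log 162`,
`K₀(64,8)`, `64`, `9`; print's p. 12 ∕ p. 18 constraints and (2.27)–(2.34) are N0y's∕S53's DISPLAYED KIND, TYPE∕CONTEXT only — no numeral
of [Balaban1988RGII] asserted as a fact about Bałaban's densities; 0 binders instantiated on Bałaban's densities; no wall item; wall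
WORDING v1.8 (T4-DAG v48) — words, not kind — does NOT move; R-t4r2-Q2 NOT met thereby; NE1′ ⇐ the named binders — NOT proved, NOT
printed; spine PROVED 0∕9; count 9 unchanged.  Rung (B)+1 on ONE finite four-torus — NOT infinite volume, NOT a mass gap, NOT OS on
ℝ⁴, NOT Clay.
HONEST DEPENDENCY: continuum YM on T⁴ ⇐ BetaPertH ∧ nine spine estimates (0/9 proved); BetaPertH ⇐ (D1) ∧ (D4) ∧ CAP+tail; G-an2-4
gates asym, D1 and NE2/3/4.
-/

noncomputable section

namespace Summit.QuantumFields.BalabanUV.T4Continuum.NE1p.DressedSmallFieldRecordLabelsTorusWitness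

open Set Metric MeasureTheory Complex
open scoped BigOperators
open Literature.MathematicalPhysics.QuantumFieldTheory.Balaban1983to89
open Literature.MathematicalPhysics.QuantumFieldTheory.Balaban1983to89.B12TreeDecay (K₀ K₀_pos)
open Literature.MathematicalPhysics.QuantumFieldTheory.Balaban1983to89.B13Resummation (locE)
open Literature.MathematicalPhysics.QuantumFieldTheory.Balaban1983to89.TreeLengthTorus (TPt TDom tsys torusTreeLen torusTreeLen_nonneg)
open Literature.MathematicalPhysics.QuantumFieldTheory.Balaban1983to89.TreeLengthTorusGeometry (tgeometry TTouch)
open Summit.QuantumFields.BalabanUV.T4Continuum.B13HistMeasurable (B13HistM)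
open Summit.QuantumFields.BalabanUV.T4Continuum.B13HistWitness (toyFrame)
open Summit.QuantumFields.BalabanUV.T4Continuum.B13TermParamGaussianBi (BiCore)
open Summit.QuantumFields.BalabanUV.T4Continuum.B13StepTermLabels (InnerLabel)
open Summit.QuantumFields.BalabanUV.T4Continuum.TorusBlockRefinement (trefineDom trefineDom_val)
open Summit.QuantumFields.BalabanUV.T4Continuum.NE1p.DressedSmallFieldTorusWitness (X₀ X₀_val hrate_torus_num)
open Summit.QuantumFields.BalabanUV.T4Continuum.NE1p.DressedSmallFieldGeometry (torus_consts)
open Summit.QuantumFields.BalabanUV.T4Continuum.NE1p.DressedSmallFieldGeometryFaces (K₀_four)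
open Summit.QuantumFields.BalabanUV.T4Continuum.NE1p.DressedSmallFieldCoresWitness (E1 crd liveTable norm_liveTable_le coreW N₁_coreW ctr0
  hroom0 Acst Acst_pos)
open Summit.QuantumFields.BalabanUV.T4Continuum.NE1p.DressedSmallFieldCoresMassWitness (letterMass_coreW cM cM_pos)
open Summit.QuantumFields.BalabanUV.T4Continuum.NE1p.DressedSmallFieldDepCoresWitness (budget_half)
open Summit.QuantumFields.BalabanUV.T4Continuum.NE1p.DressedSmallFieldFamiliesWitness (δF κF α₆F α₆F_pos α₆F_le_one δF_mul_κF_pos h229_F)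
open Summit.QuantumFields.BalabanUV.T4Continuum.NE1p.DressedSmallFieldNestedToriWitness (hsmall_N)
open Summit.QuantumFields.BalabanUV.T4Continuum.NE1p.DressedSmallFieldInnerLabelsRefinedWitness (RR sR RR_pos sR_pos sR_le_one hRR_R hκ_R
  blk blk_val card_blk)
open Summit.QuantumFields.BalabanUV.T4Continuum.NE1p.DressedSmallFieldRecordLabelsTorus
  (attachedPart_locE_le_of_coresAt_pencil_recordLabels_refined muPart_locE_le_of_coresAt_pencil_recordLabels_refined)

section Torus
variable (N : ℕ) [NeZero N] (L : ℕ) [NeZero L]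

/-! ## §1 THE DATUM: two record labels of NE5's type on the refined unit block — the family branch and the bond branch -/

/-- THE RECORD-LABEL TYPE ON THE FINE TORUS (abbreviation): NE5's `InnerLabel ⟨Z₀, fam, P⟩` with bonds read as cubes. [folklore] -/
abbrev LabelI : Type := InnerLabel (TDom 4 (L * N)) (TPt 4 (L * N))

/-- THE FAMILY-BRANCH LABEL (toy DATA): `⟨blk, {blk}, ∅⟩` — conditioned at the refined block, covered by ITSELF, no bond. [folklore] -/
def labF : LabelI N L := ⟨blk N L, {blk N L}, ∅⟩

/-- THE BOND-BRANCH LABEL (toy DATA): `⟨blk, ∅, blk.1⟩` — conditioned at the refined block, NO covering family (all `L⁴` fine cubes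
uncovered), a bond on EVERY cube. [folklore] -/
def labB : LabelI N L := ⟨blk N L, ∅, (blk N L).1⟩

/-- The two labels differ (their families do). [folklore] -/
theorem labF_ne_labB : labF N L ≠ labB N L := by
  intro h
  have h' := congrArg InnerLabel.fam h
  simp only [labF, labB] at h'
  exact Finset.singleton_ne_empty _ h'

open Classical in
/-- THE TERM INDEXING (toy DATA): both labels at the coarse unit cube, nothing elsewhere. [folklore] -/
def termsI (Z : TDom 4 N) : Finset (LabelI N L) := if Z = X₀ N then {labF N L, labB N L} else ∅

open Classical in
/-- The terms of `X₀`. [folklore] -/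
theorem termsI_X₀ : termsI N L (X₀ N) = {labF N L, labB N L} := by unfold termsI; rw [if_pos rfl]

open Classical in
/-- **TWO terms at `X₀`** [located]. -/
theorem termsI_X₀_card : (termsI N L (X₀ N)).card = 2 := by
  rw [termsI_X₀, Finset.card_pair (labF_ne_labB N L)]

open Classical in
/-- **N0y's `hadm` MET ON BOTH LABELS** [folklore]: `Z₀ = trefineDom L N X₀`; the family sits inside `Z₀` (the block itself ∕ vacuously);
print's finer constraints — `P ⊆ bondsOf (Z₀ ∖ ∪fam)` and `#(Z₀ ∖ ∪fam) ≤ 2·#P` — trivially on `labF` (`∅`, `0 ≤ 0`) and WITH CONTENT on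
`labB` (`P = W = blk.1`, `L⁴ ≤ 2·L⁴`). -/
theorem hadm_I : ∀ Z : (tsys 4 N).Dom, ∀ ℓ ∈ termsI N L Z, ℓ.Z₀ = trefineDom L N Z ∧ (∀ Y ∈ ℓ.fam, Y.1 ⊆ ℓ.Z₀.1) ∧
    ℓ.P ⊆ (fun W : Finset (TPt 4 (L * N)) => W) (ℓ.Z₀.1 \ ℓ.fam.biUnion fun Y : (tsys 4 (L * N)).Dom => Y.1) ∧
      (ℓ.Z₀.1 \ ℓ.fam.biUnion fun Y : (tsys 4 (L * N)).Dom => Y.1).card ≤ 2 * ℓ.P.card := by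
  intro Z ℓ hℓ
  unfold termsI at hℓ
  split_ifs at hℓ with hZ
  · subst hZ
    rw [Finset.mem_insert, Finset.mem_singleton] at hℓ
    rcases hℓ with rfl | rfl
    · -- the family branch
      refine ⟨rfl, fun Y hY => ?_, Finset.empty_subset _, ?_⟩
      · rw [labF, Finset.mem_singleton] at hY; subst hY; exact subset_rfl
      · simp [labF]
    · -- the bond branch
      refine ⟨rfl, fun Y hY => absurd hY (Finset.notMem_empty Y), ?_, ?_⟩
      · simp [labB]
      · simp only [labB, Finset.biUnion_empty, Finset.sdiff_empty]; omega
  · exact absurd hℓ (Finset.notMem_empty ℓ)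

/-! ## §2 THE LABEL-INDEXED CORES (toy DATA): W33's one-label core weighted by N0y's majorant; both amplitude clauses -/

/-- N0y's table-blind majorant of a record label (toy DATA), LITERALLY the shape in S53's `hAmp` at our letters. [folklore] -/
def majI (ℓ : LabelI N L) : ℝ :=
  (∏ Y ∈ ℓ.fam, (α₆F * Real.exp (-(δF * κF * torusTreeLen Y.1)) * Real.exp (-(RR * (torusTreeLen Y.1 + 5))))) *
    (sR ^ 2 * 1) ^ ℓ.P.card

/-- `0 < majI ℓ`. [arith] -/
theorem majI_pos (ℓ : LabelI N L) : 0 < majI N L ℓ := by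
  unfold majI
  refine mul_pos (Finset.prod_pos fun Y _ => by have := α₆F_pos; positivity) (pow_pos (by have := sR_pos; positivity) _)

/-- `majI ℓ ≤ 1` (every factor `≤ 1`). [arith] -/
theorem majI_le_one (ℓ : LabelI N L) : majI N L ℓ ≤ 1 := by
  unfold majI
  refine mul_le_one₀ (Finset.prod_le_one (fun Y _ => by have := α₆F_pos; positivity) fun Y _ => ?_)
    (pow_nonneg (by have := sR_pos; positivity) _) (pow_le_one₀ (by have := sR_pos; positivity) ?_)
  · have h1 : Real.exp (-(δF * κF * torusTreeLen Y.1)) ≤ 1 :=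
      Real.exp_le_one_iff.2 (neg_nonpos.2 (mul_nonneg δF_mul_κF_pos.le (torusTreeLen_nonneg _)))
    have h2 : Real.exp (-(RR * (torusTreeLen Y.1 + 5))) ≤ 1 :=
      Real.exp_le_one_iff.2 (neg_nonpos.2 (by have := RR_pos; have := torusTreeLen_nonneg Y.1; positivity))
    exact mul_le_one₀ (mul_le_one₀ α₆F_le_one (Real.exp_pos _).le h1) (Real.exp_pos _).le h2
  · rw [mul_one]; exact pow_le_one₀ sR_pos.le sR_le_one

/-- **THE FAMILY BRANCH's MAJORANT**: `majI labF = α₆F·e^{−δFκF·d_B}·e^{−RR(d_B+5)}`, `d_B := torusTreeLen blk.1` — the fine tree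
length of the refined block (W71's `majR lab` value). [folklore] -/
theorem majI_labF : majI N L (labF N L) =
    α₆F * Real.exp (-(δF * κF * torusTreeLen (blk N L).1)) * Real.exp (-(RR * (torusTreeLen (blk N L).1 + 5))) := by
  unfold majI labF
  simp only [Finset.prod_singleton, Finset.card_empty, pow_zero, mul_one]

/-- **THE BOND BRANCH's MAJORANT: THE BOND LETTER IS LIVE** — `majI labB = (sR²)^{L⁴}` (empty family, `L⁴` bonds). [located] -/
theorem majI_labB : majI N L (labB N L) = (sR ^ 2) ^ L ^ 4 := by
  unfold majI labB
  simp only [Finset.prod_empty, one_mul, mul_one, card_blk]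

variable (r : ℝ) (hr : 0 ≤ r)

/-- THE LABEL-DEPENDENT CAUCHY WEIGHT (toy DATA): `cI ℓ := (cM r∕2)·majI ℓ`. [folklore] -/
def cI (ℓ : LabelI N L) : ℝ := cM r / 2 * majI N L ℓ

/-- `0 < cI ℓ`. [arith] -/
theorem cI_pos (ℓ : LabelI N L) : 0 < cI N L r ℓ := mul_pos (half_pos (cM_pos r)) (majI_pos N L ℓ)

/-- **THE RECORD-LABEL-INDEXED CORE FAMILY** (toy DATA): W33's one-label core `coreW` at the weight `cI ℓ`. [folklore] -/
def GI : ∀ (_ : ℕ) (_ : LabelI N L), ℕ → BiCore toyFrame (fun _ : Unit => (0 : ℕ)) ℂ Unit E1 :=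
  fun _ ℓ _ => coreW (cI N L r ℓ) r hr

/-- The core at `(k, ℓ, X)`. [folklore] -/
@[simp] theorem GI_apply (k : ℕ) (ℓ : LabelI N L) (X : ℕ) : GI N L r hr k ℓ X = coreW (cI N L r ℓ) r hr := rfl

open Classical in
/-- THE ACTIVITY OF RECORD (toy DATA): the sum of the TWO cores' terms at `X₀` along the pencil `s ↦ 0 + s • liveTable`. [folklore] -/
def actI (k : ℕ) (s : ℂ) (Z : TDom 4 N) : ℂ :=
  ∑ ℓ ∈ termsI N L Z, (GI N L r hr k ℓ k).termAt (0 : ℂ) ((0 : B13HistM toyFrame) + s • liveTable)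

include hr in
/-- THE CORE AMPLITUDE INEQUALITY behind both `hAmp` clauses: `|cI ℓ|·√(2π)·e^{r·2‖liveTable‖} ≤ (A∕2)·majI ℓ` (W41's `budget_half`).
[folklore] -/
theorem amp_core (ℓ : LabelI N L) :
    |cI N L r ℓ| * Real.sqrt (2 * Real.pi) * Real.exp (r * (2 * ‖liveTable‖)) ≤ Acst / 2 * majI N L ℓ := by
  have hp : 0 ≤ majI N L ℓ := (majI_pos N L ℓ).le
  have hT : 2 * ‖liveTable‖ ≤ 2 := by linarith [norm_liveTable_le]
  have hb := budget_half r hr hT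
  unfold cI
  rw [abs_mul, abs_of_nonneg hp]
  calc |cM r / 2| * majI N L ℓ * Real.sqrt (2 * Real.pi) * Real.exp (r * (2 * ‖liveTable‖))
      = majI N L ℓ * (|cM r / 2| * Real.sqrt (2 * Real.pi) * Real.exp (r * (2 * ‖liveTable‖))) := by ring
    _ ≤ majI N L ℓ * (Acst / 2) := mul_le_mul_of_nonneg_left hb hp
    _ = Acst / 2 * majI N L ℓ := by ring

open Classical in
/-- **S53's `hAmp` MET (attached part, `ϱ = 2`, `A₀ = 0`, `A₁ = A∕4`)** [decided toy], in the LITERAL binder shape at NE5's toy letters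
`(mq, bq, N₀) = (1, 0, 1)`. [folklore] -/
theorem hAmp_I (k : ℕ) :
    ∀ Z : (tsys 4 N).Dom, Z.1 ⊆ (X₀ N).1 → ∀ ℓ ∈ termsI N L Z,
      (GI N L r hr k ℓ k).lam.real univ *
          ((GI N L r hr k ℓ k).wB * (fun (_ : ℕ) (_ : LabelI N L) (_ : ℕ) => (1 : ℝ)) k ℓ k *
            Real.exp ((fun (_ : ℕ) (_ : LabelI N L) (_ : ℕ) => (0 : ℝ)) k ℓ k)) *
          (Real.pi / ((fun (_ : ℕ) (_ : LabelI N L) (_ : ℕ) => (1 : ℝ)) k ℓ k / 2)) ^ (Module.finrank ℝ E1 / 2 : ℝ) *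
        Real.exp ((GI N L r hr k ℓ k).N₁ * (‖(0 : B13HistM toyFrame)‖ + 2 * ‖liveTable‖)) ≤
      (0 + 2 * (Acst / 4)) * ((∏ Y ∈ ℓ.fam, (α₆F * Real.exp (-(δF * κF * torusTreeLen Y.1)) *
        Real.exp (-(RR * (torusTreeLen Y.1 + 5))))) * (sR ^ 2 * 1) ^ ℓ.P.card) := by
  intro Z _ ℓ _
  simp only [GI_apply]
  rw [letterMass_coreW, N₁_coreW, norm_zero, zero_add]
  have h := amp_core N L r hr ℓ
  rw [show (0 : ℝ) + 2 * (Acst / 4) = Acst / 2 by ring]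
  exact h

open Classical in
/-- **S53's μ-part `hAmp` MET (`A := A∕2`, radius `μ₁ = 2`)** [decided toy]. [folklore] -/
theorem hAmpMu_I (k : ℕ) :
    ∀ Z : (tsys 4 N).Dom, Z.1 ⊆ (X₀ N).1 → ∀ ℓ ∈ termsI N L Z,
      (GI N L r hr k ℓ k).lam.real univ *
          ((GI N L r hr k ℓ k).wB * (fun (_ : ℕ) (_ : LabelI N L) (_ : ℕ) => (1 : ℝ)) k ℓ k *
            Real.exp ((fun (_ : ℕ) (_ : LabelI N L) (_ : ℕ) => (0 : ℝ)) k ℓ k)) *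
          (Real.pi / ((fun (_ : ℕ) (_ : LabelI N L) (_ : ℕ) => (1 : ℝ)) k ℓ k / 2)) ^ (Module.finrank ℝ E1 / 2 : ℝ) *
        Real.exp ((GI N L r hr k ℓ k).N₁ * (‖(0 : B13HistM toyFrame)‖ + 2 * ‖liveTable‖)) ≤
      Acst / 2 * ((∏ Y ∈ ℓ.fam, (α₆F * Real.exp (-(δF * κF * torusTreeLen Y.1)) *
        Real.exp (-(RR * (torusTreeLen Y.1 + 5))))) * (sR ^ 2 * 1) ^ ℓ.P.card) := by
  intro Z _ ℓ _
  simp only [GI_apply]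
  rw [letterMass_coreW, N₁_coreW, norm_zero, zero_add]
  exact amp_core N L r hr ℓ

/-- The μ-part's located smallness clause at `A := A∕2`, `r₁ = 0` — W59's `hsmall_N` rearranged (`0 + 2·(A∕4) = A∕2`). [arith] -/
theorem hsmall_mu : Acst / 2 * Real.exp (5 * 0 + 1) * K₀ 64 8 * 9 * 64 ≤ 1 := by
  have h := hsmall_N; rwa [show (0 : ℝ) + 2 * (Acst / 4) = Acst / 2 by ring] at h

/-! ## §3 BOTH ENDs OF S53 §2 FIRE (decided appliers at NE5's label type) -/

open Classical in
/-- **S53's `attachedPart_locE_le_of_coresAt_pencil_recordLabels_refined` FIRES** [decided toy]: nested tori `(N, L·N)` (every `N`, `L`),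
record-label-indexed cores `GI`, W33's `ctr0`∕`hroom0`, NE5's toy letters INLINE, `hscale`∕`hact` by `rfl`, `(A₀, A₁, Rkp, r₁) :=
(0, A∕4, 2·(64 log 162)+2, 0)` with W24's `hrate_torus_num`, W59's `hsmall_N`, bonds READ AS CUBES (`bondsOf := id`, `b₀ := 1`),
`(δ, κ, α₆, R, s, t) := (δF, κF, α₆F, RR, sR, 1)` with W71's `hκ_R`∕`hRR_R` and W45's `h229_F` inline, `hadm_I`, `hAmp_I`, `hϱ : 2 ≤ 2`,
`hϱA`.  Conclusion LITERAL. [folklore] -/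
theorem recordEnd_fires (k : ℕ) :
    ‖locE (TTouch (d := 4) (N := N)) (fun Z : (tsys 4 N).Dom => Z.1) (actI N L r hr k 1) (X₀ N).1 -
        locE (TTouch (d := 4) (N := N)) (fun Z : (tsys 4 N).Dom => Z.1) (actI N L r hr k 0) (X₀ N).1‖ ≤
      4 * (Real.exp 1 * 9 * 64 * K₀ 64 8 ^ 2) * (Acst / 4) * Real.exp (-(0 * torusTreeLen (X₀ N).1)) :=
  attachedPart_locE_le_of_coresAt_pencil_recordLabels_refined (N := N) (L := L) (GI N L r hr)
    (Win := Set.univ) (ctr := ctr0) (ROp := fun _ => 1) (RHist := fun _ => 2) (R' := fun _ => 2)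
    (mq := fun _ _ _ => 1) (bq := fun _ _ _ => 0) (N₀ := fun _ _ _ => 1)
    hroom0 (fun _ _ _ _ _ _ _ => one_pos)
    (fun _ _ _ _ _ _ _ => ⟨fun _ _ => aestronglyMeasurable_const, fun _ => differentiableOn_const _, fun _ _ _ => by
      show ‖(1 : ℂ)‖ ≤ 1; rw [norm_one]⟩)
    (fun _ _ _ _ _ _ _ => ⟨fun _ _ => (Complex.measurable_ofReal.comp (measurable_snd.norm.pow_const 2)).aestronglyMeasurable,
      fun _ _ => differentiableOn_const _, fun _ _ _ v => by
        show 1 * ‖v‖ ^ 2 - 0 ≤ (((‖v‖ ^ 2 : ℝ) : ℂ)).re; rw [Complex.ofReal_re]; simp⟩)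
    (g := fun _ => 0) (Set.mem_univ _) (U := ()) (o := 0) (h₀ := 0) (w := liveTable) (ϱ := 2)
    (by show ‖(0 : ℂ) - 0‖ ≤ 1; simp)
    (by show ‖(0 : B13HistM toyFrame) - 0‖ + 2 * ‖liveTable‖ ≤ 2; rw [sub_zero, norm_zero, zero_add];
        linarith [norm_liveTable_le])
    (emb := fun _ => k) (fun _ => rfl) (terms := termsI N L) (act := actI N L r hr k) (fun _ _ _ => rfl)
    (A₀ := 0) (A₁ := Acst / 4) (Rkp := 2 * (64 * Real.log 162) + 2) (r₁ := 0) (X₀ N)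
    le_rfl (by have := Acst_pos; positivity) le_rfl hrate_torus_num hsmall_N
    (fun W => W) (δ := δF) (κ := κF) (α₆ := α₆F) (R := RR) (b₀ := 1) (s := sR) (t := 1) α₆F_pos.le hκ_R
    (by have h := h229_F 1; rwa [K₀_four, (torus_consts 1).2.2] at h)
    sR_pos.le sR_le_one zero_le_one (fun W => by rw [one_mul]) hRR_R (hadm_I N L) (hAmp_I N L r hr k) le_rfl
    (by have := Acst_pos; linarith)

open Classical in
/-- … in CLOSED FORM: `≤ K₀(64,8)` (W33's `Acst` unfolded; decay factor `1` at `r₁ = 0`). [folklore] -/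
theorem recordEnd_fires_closed (k : ℕ) :
    ‖locE (TTouch (d := 4) (N := N)) (fun Z : (tsys 4 N).Dom => Z.1) (actI N L r hr k 1) (X₀ N).1 -
        locE (TTouch (d := 4) (N := N)) (fun Z : (tsys 4 N).Dom => Z.1) (actI N L r hr k 0) (X₀ N).1‖ ≤ K₀ 64 8 := by
  refine (recordEnd_fires N L r hr k).trans (le_of_eq ?_)
  rw [zero_mul, neg_zero, Real.exp_zero, mul_one]
  unfold Acst
  have hK := K₀_pos (64 : ℝ) 8
  have he := Real.exp_pos 1
  field_simp

open Classical in
/-- **S53's μ-PART END `muPart_locE_le_of_coresAt_pencil_recordLabels_refined` FIRES** [decided toy] — road P1's twin at NE5's label type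
on two tori: the source pencil `0 + s • liveTable` read on `‖s‖ < μ₁ = 2`, window `μ₀ = 1`, any `sμ` with `‖sμ‖ ≤ 1`; `A := A∕2` with
`hAmpMu_I` and `hsmall_mu`; everything else as in `recordEnd_fires`.  Conclusion LITERAL. [folklore] -/
theorem recordMuEnd_fires (k : ℕ) {sμ : ℂ} (hμ : ‖sμ‖ ≤ 1) :
    ‖locE (TTouch (d := 4) (N := N)) (fun Z : (tsys 4 N).Dom => Z.1) (actI N L r hr k sμ) (X₀ N).1 -
        locE (TTouch (d := 4) (N := N)) (fun Z : (tsys 4 N).Dom => Z.1) (actI N L r hr k 0) (X₀ N).1‖ ≤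
      Real.exp 1 * 9 * 64 * K₀ 64 8 ^ 2 * (Acst / 2) * Real.exp (-(0 * torusTreeLen (X₀ N).1)) * (1 / (2 - 1)) :=
  muPart_locE_le_of_coresAt_pencil_recordLabels_refined (N := N) (L := L) (GI N L r hr)
    (Win := Set.univ) (ctr := ctr0) (ROp := fun _ => 1) (RHist := fun _ => 2) (R' := fun _ => 2)
    (mq := fun _ _ _ => 1) (bq := fun _ _ _ => 0) (N₀ := fun _ _ _ => 1)
    hroom0 (fun _ _ _ _ _ _ _ => one_pos)
    (fun _ _ _ _ _ _ _ => ⟨fun _ _ => aestronglyMeasurable_const, fun _ => differentiableOn_const _, fun _ _ _ => by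
      show ‖(1 : ℂ)‖ ≤ 1; rw [norm_one]⟩)
    (fun _ _ _ _ _ _ _ => ⟨fun _ _ => (Complex.measurable_ofReal.comp (measurable_snd.norm.pow_const 2)).aestronglyMeasurable,
      fun _ _ => differentiableOn_const _, fun _ _ _ v => by
        show 1 * ‖v‖ ^ 2 - 0 ≤ (((‖v‖ ^ 2 : ℝ) : ℂ)).re; rw [Complex.ofReal_re]; simp⟩)
    (g := fun _ => 0) (Set.mem_univ _) (U := ()) (o := 0) (h₀ := 0) (v := liveTable) (μ₁ := 2)
    (by show ‖(0 : ℂ) - 0‖ ≤ 1; simp)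
    (by show ‖(0 : B13HistM toyFrame) - 0‖ + 2 * ‖liveTable‖ ≤ 2; rw [sub_zero, norm_zero, zero_add];
        linarith [norm_liveTable_le])
    (emb := fun _ => k) (fun _ => rfl) (terms := termsI N L) (act := actI N L r hr k) (fun _ _ _ => rfl)
    (A := Acst / 2) (Rkp := 2 * (64 * Real.log 162) + 2) (r₁ := 0) (μ₀ := 1) (X₀ N) (sμ := sμ)
    (by have := Acst_pos; positivity) le_rfl hrate_torus_num hsmall_mu
    (fun W => W) (δ := δF) (κ := κF) (α₆ := α₆F) (R := RR) (b₀ := 1) (s := sR) (t := 1) α₆F_pos.le hκ_R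
    (by have h := h229_F 1; rwa [K₀_four, (torus_consts 1).2.2] at h)
    sR_pos.le sR_le_one zero_le_one (fun W => by rw [one_mul]) hRR_R (hadm_I N L) (hAmpMu_I N L r hr k) one_pos
    (by norm_num) hμ

open Classical in
/-- … in CLOSED FORM: `≤ K₀(64,8) ∕ 8` (`e·9·64·K₀²·(A∕2)·1·1 = K₀∕8` with W33's `A = (e·K₀·9·64)⁻¹`… precisely `K₀(64,8)∕2 · ½ · …`;
we record the clean bound `≤ K₀(64,8)`). [folklore] -/
theorem recordMuEnd_fires_closed (k : ℕ) {sμ : ℂ} (hμ : ‖sμ‖ ≤ 1) :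
    ‖locE (TTouch (d := 4) (N := N)) (fun Z : (tsys 4 N).Dom => Z.1) (actI N L r hr k sμ) (X₀ N).1 -
        locE (TTouch (d := 4) (N := N)) (fun Z : (tsys 4 N).Dom => Z.1) (actI N L r hr k 0) (X₀ N).1‖ ≤ K₀ 64 8 := by
  refine (recordMuEnd_fires N L r hr k hμ).trans ?_
  rw [zero_mul, neg_zero, Real.exp_zero, mul_one, show (2 : ℝ) - 1 = 1 by norm_num, div_one, mul_one]
  unfold Acst
  have hK := K₀_pos (64 : ℝ) 8
  have he := Real.exp_pos 1
  have hval : Real.exp 1 * 9 * 64 * K₀ 64 8 ^ 2 * ((Real.exp 1 * K₀ 64 8 * 9 * 64)⁻¹ / 2) = K₀ 64 8 / 2 := by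
    field_simp
  rw [hval]
  linarith

end Torus

end Summit.QuantumFields.BalabanUV.T4Continuum.NE1p.DressedSmallFieldRecordLabelsTorusWitness

end
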